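import Mathlib
import Summits.QuantumFields.YangMills.Theorems.ParabolicTrajectoryContinuumLimitOnTrajectoryStubArp
import Summits.QuantumFields.YangMills.Theorems.ParabolicTrajectoryContinuumLimitOnTrajectoryUvbOfUuvb
import Summits.QuantumFields.YangMills.Theorems.ParabolicTrajectoryContinuumLimitOnTrajectorySlabRP
import HarnessLib

/-!
# `ContinuumLegGivenGap` (stmt-QuantumFields-15828), line `Sketch` (reshape 11): (ARP) and (UVB) from exact
# lattice reflection positivity and uniform plaquette-string bounds — `stub_arp`, `stub_uvb`

Support file for the crux item stmt-QuantumFields-15828 (registered stubs `stub_arp`, `stub_uvb` of line `Sketch`,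
reshape 11: UV-discharge dock on the compactness socket stmt-15926 `FlowLineStateSpace.OSLimitFromUniformBounds`).

The socket consumes, for the smeared torus functional of the renormalised curvature
`LS k n F = ∫ ∑ₓ F(a_k x) ∏ᵢ (c_k a_k⁴ (P(τ_{xᵢ}Ũ) − m_k)) dμ_{β_k}`, the finite-list asymptotic reflection
positivity (ARP) and the E0′-type bound (UVB). For a CANONICALLY normalised curvature (`c_k = a_k⁻⁴`, (CAN)) with
exact centring (`m_k` = torus Wilson mean, (VS)) this functional IS route ParabolicTrajectory's
`curvDistribution r sch k n` (crux stmt-10522, line `two-orbit-synchronisation`), for which the tree proves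
`stub_arp : TorusSlabRP → UUVB → UVB → ARP` (exact Osterwalder–Seiler positivity of slab observables on the odd
tori `2L_k+1` — `torusSlabRP_of_tendsto`, from `β_k → ∞` — plus the time-chirality defect of the corner action
density controlled by the uniform-threshold plaquette-string bounds (UUVB)) and `uvb_of_uuvb : UUVB → UVB`.
So for our line: (defining equation of `LS`) ∧ AF ∧ (CAN) ∧ (VS) ∧ (UUVB) ⇒ (ARP) (`stub_arp`) and
(CAN) ∧ (VS) ∧ (UUVB) ⇒ (UVB) (`stub_uvb`) — the UV stub of the line delivers (UUVB) (stated in tree vocabulary: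
corner plaquettes `plaquetteObs r.ρ 0 μ ν`, `wilsonTorusMean`) instead of (UVB) ∧ (ARP). [folklore]
-/

noncomputable section

namespace Summit.QuantumFields.YangMills.Theorems.ContinuumLegGivenGap

open scoped SchwartzMap
open Filter Topology MeasureTheory
open Literature.MathematicalPhysics.QuantumFieldTheory Literature.MathematicalPhysics.QuantumLattice
  Literature.MathematicalPhysics.AQFT Literature.Probability.LatticeModels
open Summit.QuantumFields.YangMills.Cruxes.ContinuumLimitOnTrajectory.TwoOrbitSynchronisation
  (curvDistribution canonDistribution plaq UUVB torusSlabRP_of_tendsto uvb_of_uuvb)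

variable {G : Type} [Group G] [TopologicalSpace G] [IsTopologicalGroup G] [CompactSpace G]
  [MeasurableSpace G] [BorelSpace G]

/-- **Bridge**: with the canonical normalisation `c_k = a_k⁻⁴` of the curvature and exact centring by the torus
Wilson mean, the socket's functional is route ParabolicTrajectory's `curvDistribution`. [folklore] -/
theorem lsk_eq_curvDistribution (r : LatticeRep G) (sch : SpeciesScheme (YMSpecies G))
    (LS : (k n : ℕ) → 𝓢((Fin n → EuclideanSpace ℝ (Fin 4)), ℂ) → ℂ)
    (hLS : ∀ (k n : ℕ) (F : 𝓢((Fin n → EuclideanSpace ℝ (Fin 4)), ℂ)), LS k n F =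
      ∫ U : GaugeConfig 4 (sch.side k) G, ∑ x : Fin n → ↥(box 4 (sch.L k)),
        F (fun i => sch.a k • siteToE ↑(x i)) *
          ∏ i, ((sch.c r.curvature k * sch.a k ^ 4 *
            (r.curvature.F (configShift (-↑(x i)) (torusLift (sch.side k) U)) - sch.m r.curvature k) : ℝ) : ℂ)
        ∂(wilsonMeasure r.ρ (sch.β k)))
    (hCAN : ∀ k : ℕ, sch.c r.curvature k = (sch.a k ^ 4)⁻¹)
    (hVS : ∀ k : ℕ, sch.m r.curvature k =
      ∫ U : GaugeConfig 4 (sch.side k) G, r.curvature.F (torusLift (sch.side k) U) ∂(wilsonMeasure r.ρ (sch.β k)))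
    (k n : ℕ) (F : 𝓢((Fin n → EuclideanSpace ℝ (Fin 4)), ℂ)) :
    LS k n F = curvDistribution r sch k n F := by
  have hm : sch.m r.curvature k = wilsonTorusMean r.ρ (sch.β k) (sch.L k) r.curvature.F := hVS k
  rw [hLS]
  unfold curvDistribution
  simp_rw [hCAN k, hm]

/-- **Bridge for the plaquette strings**: the unfolded uniform-threshold bound (UUVB) of the line, stated with corner
plaquettes `plaquetteObs r.ρ 0 μ ν`, is route ParabolicTrajectory's `UUVB r sch`. [folklore] -/
theorem uuvb_of_unfolded (r : LatticeRep G) (sch : SpeciesScheme (YMSpecies G))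
    (h : ∃ (s : ℕ) (α β' : ℝ), ∀ᶠ k in atTop, ∀ (p : ℕ) (q : Fin p → {q : Fin 4 × Fin 4 // q.1 < q.2})
      (F : 𝓢((Fin p → EuclideanSpace ℝ (Fin 4)), ℂ)), IsOffDiagonal F →
      ‖∫ U : GaugeConfig 4 (sch.side k) G, ∑ x : Fin p → ↥(box 4 (sch.L k)),
          F (fun i => sch.a k • siteToE ↑(x i)) *
            ∏ i, ((plaquetteObs r.ρ 0 (q i).1.1 (q i).1.2 (configShift (-↑(x i)) (torusLift (sch.side k) U)) -
              wilsonTorusMean r.ρ (sch.β k) (sch.L k) (plaquetteObs r.ρ 0 (q i).1.1 (q i).1.2) : ℝ) : ℂ)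
          ∂(wilsonMeasure r.ρ (sch.β k))‖ ≤ α * (p.factorial : ℝ) ^ β' * schwartzNorm (p * s) F) :
    UUVB r sch := by
  obtain ⟨s, α, β', h⟩ := h
  exact ⟨s, α, β', h.mono fun k hk p q F hF => hk p q F hF⟩

/-- `stub_arp` — **(ARP) from exact lattice reflection positivity** (registered stub of stmt-QuantumFields-15828,
line `Sketch`, reshape 11): for a weak-coupling scheme (`β_k → +∞`, so `β_k ≥ 0` eventually) whose curvature is
canonically normalised (`c_k = a_k⁻⁴`, (CAN)) and exactly centred ((VS)), the uniform-threshold plaquette-string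
bounds (UUVB) imply the finite-list asymptotic reflection positivity (ARP) of the socket stmt-15926 for the
functional `LS`. Proof: `LS = curvDistribution r sch` (bridge) and route ParabolicTrajectory's landed
`stub_arp : TorusSlabRP → UUVB → UVB → ARP` with `torusSlabRP_of_tendsto` (odd-torus Osterwalder–Seiler positivity,
tree `WilsonOddRPNegCoords`) and `uvb_of_uuvb`. [folklore] -/
theorem stub_arp :
    ∀ (G : Type) [Group G] [TopologicalSpace G] [IsTopologicalGroup G] [CompactSpace G]
      [MeasurableSpace G] [BorelSpace G], IsCompactSimpleLieGroup G →
      ∀ (r : LatticeRep G) (sch : SpeciesScheme (YMSpecies G))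
        (LS : (k n : ℕ) → SchwartzMap (Fin n → EuclideanSpace ℝ (Fin 4)) ℂ → ℂ),
      (∀ (k n : ℕ) (F : SchwartzMap (Fin n → EuclideanSpace ℝ (Fin 4)) ℂ), LS k n F =
        ∫ U : GaugeConfig 4 (sch.side k) G, ∑ x : Fin n → ↥(box 4 (sch.L k)),
          F (fun i => sch.a k • siteToE ↑(x i)) *
            ∏ i, ((sch.c r.curvature k * sch.a k ^ 4 *
              (r.curvature.F (configShift (-↑(x i)) (torusLift (sch.side k) U)) - sch.m r.curvature k) : ℝ) : ℂ)
          ∂(wilsonMeasure r.ρ (sch.β k))) →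
      Tendsto sch.β atTop atTop →
      (∀ k : ℕ, sch.c r.curvature k = (sch.a k ^ 4)⁻¹) →
      (∀ k : ℕ, sch.m r.curvature k =
        ∫ U : GaugeConfig 4 (sch.side k) G, r.curvature.F (torusLift (sch.side k) U) ∂(wilsonMeasure r.ρ (sch.β k))) →
      (∃ (s : ℕ) (α β' : ℝ), ∀ᶠ k in atTop, ∀ (p : ℕ) (q : Fin p → {q : Fin 4 × Fin 4 // q.1 < q.2})
        (F : SchwartzMap (Fin p → EuclideanSpace ℝ (Fin 4)) ℂ), IsOffDiagonal F →
        ‖∫ U : GaugeConfig 4 (sch.side k) G, ∑ x : Fin p → ↥(box 4 (sch.L k)),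
            F (fun i => sch.a k • siteToE ↑(x i)) *
              ∏ i, ((plaquetteObs r.ρ 0 (q i).1.1 (q i).1.2 (configShift (-↑(x i)) (torusLift (sch.side k) U)) -
                wilsonTorusMean r.ρ (sch.β k) (sch.L k) (plaquetteObs r.ρ 0 (q i).1.1 (q i).1.2) : ℝ) : ℂ)
            ∂(wilsonMeasure r.ρ (sch.β k))‖ ≤ α * (p.factorial : ℝ) ^ β' * schwartzNorm (p * s) F) →
      ∀ (N : ℕ) (deg : Fin N → ℕ) (F : (j : Fin N) → SchwartzMap (Fin (deg j) → EuclideanSpace ℝ (Fin 4)) ℂ),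
        (∀ j, IsTimeOrdered (F j)) →
          ∀ H : (i j : Fin N) → SchwartzMap (Fin (deg i + deg j) → EuclideanSpace ℝ (Fin 4)) ℂ,
            (∀ i j, IsAppendTensorOf (H i j) (osAdjoint (F i)) (F j)) → ∀ ε : ℝ, 0 < ε →
              ∀ᶠ k in atTop, -ε ≤ (∑ i, ∑ j, LS k (deg i + deg j) (H i j)).re ∧
                |(∑ i, ∑ j, LS k (deg i + deg j) (H i j)).im| ≤ ε := by
  intro G _ _ _ _ _ _ _ r sch LS hLS hAF hCAN hVS hUUVB N deg F hF H hH ε hε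
  have hU : UUVB r sch := uuvb_of_unfolded r sch hUUVB
  have hARP := Summit.QuantumFields.YangMills.Cruxes.ContinuumLimitOnTrajectory.TwoOrbitSynchronisation.stub_arp
    G r sch (torusSlabRP_of_tendsto r sch hAF) hU (uvb_of_uuvb r sch hU) N deg F hF H hH ε hε
  simp only [lsk_eq_curvDistribution r sch LS hLS hCAN hVS]
  exact hARP

/-- `stub_uvb` — **(UVB) for the socket's functional from the plaquette-string bounds** (registered stub of
stmt-QuantumFields-15828, line `Sketch`, reshape 11): with (CAN) and (VS), `LS = curvDistribution r sch`, and route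
ParabolicTrajectory's landed `uvb_of_uuvb` (multilinearity in the six corner plaquettes, `6^p ≤ 65·p!`) turns the
uniform-threshold string bounds (UUVB) into the E0′-type bound (UVB) the socket stmt-15926 consumes. [folklore] -/
theorem stub_uvb :
    ∀ (G : Type) [Group G] [TopologicalSpace G] [IsTopologicalGroup G] [CompactSpace G]
      [MeasurableSpace G] [BorelSpace G] (r : LatticeRep G) (sch : SpeciesScheme (YMSpecies G))
        (LS : (k n : ℕ) → SchwartzMap (Fin n → EuclideanSpace ℝ (Fin 4)) ℂ → ℂ),
      (∀ (k n : ℕ) (F : SchwartzMap (Fin n → EuclideanSpace ℝ (Fin 4)) ℂ), LS k n F =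
        ∫ U : GaugeConfig 4 (sch.side k) G, ∑ x : Fin n → ↥(box 4 (sch.L k)),
          F (fun i => sch.a k • siteToE ↑(x i)) *
            ∏ i, ((sch.c r.curvature k * sch.a k ^ 4 *
              (r.curvature.F (configShift (-↑(x i)) (torusLift (sch.side k) U)) - sch.m r.curvature k) : ℝ) : ℂ)
          ∂(wilsonMeasure r.ρ (sch.β k))) →
      (∀ k : ℕ, sch.c r.curvature k = (sch.a k ^ 4)⁻¹) →
      (∀ k : ℕ, sch.m r.curvature k =
        ∫ U : GaugeConfig 4 (sch.side k) G, r.curvature.F (torusLift (sch.side k) U) ∂(wilsonMeasure r.ρ (sch.β k))) →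
      (∃ (s : ℕ) (α β' : ℝ), ∀ᶠ k in atTop, ∀ (p : ℕ) (q : Fin p → {q : Fin 4 × Fin 4 // q.1 < q.2})
        (F : SchwartzMap (Fin p → EuclideanSpace ℝ (Fin 4)) ℂ), IsOffDiagonal F →
        ‖∫ U : GaugeConfig 4 (sch.side k) G, ∑ x : Fin p → ↥(box 4 (sch.L k)),
            F (fun i => sch.a k • siteToE ↑(x i)) *
              ∏ i, ((plaquetteObs r.ρ 0 (q i).1.1 (q i).1.2 (configShift (-↑(x i)) (torusLift (sch.side k) U)) -
                wilsonTorusMean r.ρ (sch.β k) (sch.L k) (plaquetteObs r.ρ 0 (q i).1.1 (q i).1.2) : ℝ) : ℂ)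
            ∂(wilsonMeasure r.ρ (sch.β k))‖ ≤ α * (p.factorial : ℝ) ^ β' * schwartzNorm (p * s) F) →
      ∃ (s : ℕ) (α β' : ℝ), ∀ (n : ℕ) (F : SchwartzMap (Fin n → EuclideanSpace ℝ (Fin 4)) ℂ),
        IsOffDiagonal F → ∀ᶠ k in atTop, ‖LS k n F‖ ≤ α * (n.factorial : ℝ) ^ β' * schwartzNorm (n * s) F := by
  intro G _ _ _ _ _ _ r sch LS hLS hCAN hVS hUUVB
  obtain ⟨s, α, β', h⟩ := uvb_of_uuvb r sch (uuvb_of_unfolded r sch hUUVB)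
  refine ⟨s, α, β', fun n F hF => ?_⟩
  simp only [lsk_eq_curvDistribution r sch LS hLS hCAN hVS]
  exact h n F hF

end Summit.QuantumFields.YangMills.Theorems.ContinuumLegGivenGap

end
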